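import Summits.Ventures.PercRepro.RankLevelSetDepCountGen
import Summits.Ventures.PercRepro.RankLevelSetLevelFive
import Summits.Ventures.PercRepro.RankLevelSetDepCountGiantB2
import Summits.Ventures.PercRepro.RankLevelSetLevelFiveArithPartA
import Summits.Ventures.PercRepro.RankLevelSetLevelFiveArithPartB
import Summits.Ventures.PercRepro.RankLevelSetLevelFiveArithPart8
import Summits.Ventures.PercRepro.RankLevelSetLevelFiveGiant
import Summits.Ventures.PercRepro.RankLevelSetLevelSplitAll
import Summits.Ventures.PercRepro.S1LevelFour
import Summits.Ventures.PercRepro.S1TriangleCount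
import Summits.Ventures.PercRepro.S1FourCircuitCount
import Summits.Ventures.PercRepro.RankLevelSetPlaneTenPrime
import Summits.Ventures.PercRepro.RankLevelSetCoreFiveNineteen
import Summits.Ventures.PercRepro.RankLevelSetCorankFiveCounts
import Summits.Ventures.PercRepro.S2FiveWindow
import Summits.Ventures.PercRepro.S2FlatTail
import Summits.Ventures.PercRepro.S2FlatTailBounds
import Summits.Ventures.PercRepro.S2FlatTailBounds16
import Summits.Ventures.PercRepro.S2FlatTailBoundsPart
import Summits.Ventures.PercRepro.S2CellsII
import Summits.Ventures.PercRepro.RankLevelSetCoreFiveTwentyNine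
import Summits.Ventures.PercRepro.S2SquareGiantCount

/-!
# PercRepro — THEOREM C₅ IN THE PARTITION FORM: C-025 AT LEVEL `5` FOR EVERY FINITE MATROID AND EVERY `p ≥ 33`
(p7, gen 2; sub-claim S2)

`proofs/SUBCLAIM-S2-p7.md` R3′, the PARTITION chain. The `U`-side is the square-multiplicity count in its PARTITION form
(`S2.ncard_eRk_eq_ncard_le_le_giant_sq'`: the small / mid / giant pairs partition the pairs, so the count is
`C(n,5) + σ_m·P_E + (σ_g − σ_s)·P_{F_max}`), with the nullity cap, `f(5) ≤ 19`, Lemmas T and T4 as before; the `Y`-side is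
the flat tail (`S2FlatTail`) with the `15/16` bounds for the coranks `6 … 19` (`S2FlatTailBoundsPart`), the `7/8` bounds
for the coranks `20 … 25`, and — for the six cells `(32, 23), (32, 24), (33, 24), (32, 25), (33, 25), (34, 25)` below the
tail bases — the regime-II count `#Y ≥ C(n, p − 1)` (`choose_le_midCount_of_bound`) with the numeral cells `S2CellsII`.
The polynomial inequalities: `level_five_poly_part` (`15/16`, `d ≤ 19`, RankLevelSetLevelFiveArithPartA/B) and `level_five_poly_part8` (`7/8`, `20 ≤ d ≤ 25`, ArithPart8),
both at `p ≥ 32`; coranks `≥ 26` by `c025_core_five_nineteen` (`p ≥ 27`).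

* **`c025_core_five_bounded_corank_part`** — the `e`-free core at level `5`, corank `6 ≤ d ≤ 25`, rank `p ≥ 32`;
* **`c025_five_of_four_part_from`** — for `P ≥ 32`, level `4` for all `p ≥ P` implies level `5` for all `p ≥ P + 1`;
* **`c025_five_of_four_part`** — level `4` for all `p ≥ 32` implies level `5` for every `p ≥ 33`;
* **`c025_five_large_part`** — UNCONDITIONAL over the landed tree: C-025 at level `5` for every `p ≥ 44` (level `4` from
  the split row, `p ≥ 43`);
* **`c025_five_large_part33`** — UNCONDITIONAL over the landed tree: C-025 at level `5` for every `p ≥ 33` (level `4`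
  from S1's `c025_four_twentyseven`, S1LevelFour, `p ≥ 27`); `c025_five_large_part33'` is the `C025` spelling.
Axioms: standard.
-/

open scoped Matroid

namespace PercRepro

/-- **`(P_d)` at level `5` in the `15/16` form, PARTITION count, every corank `6 ≤ d ≤ 19`, every `p ≥ 32`, in `ℚ`** — the
dispatcher of the fourteen cases of RankLevelSetLevelFiveArithPartA/B used by the chain. -/
theorem level_five_poly_part (d : ℕ) (hd1 : 6 ≤ d) (hd2 : d ≤ 19) (p : ℕ) (hp : 32 ≤ p) :
    16 * (((p + d).choose 5 : ℚ) +
      (∑ j ∈ Finset.range (d - 5), (Nat.choose (min 13 ((d + 6) / 2 + 1 - 2)) j : ℚ) / ((j + 1) ^ 2)) *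
        ((d * (d + 1) / 2 * (p + d).choose 3 + d * (d + 1) * (d + 2) / 3 * (p + d).choose 2 + (d + 4).choose 5 * (p + d) + (d + 5).choose 6 : ℕ) : ℚ) +
      ((∑ j ∈ Finset.range (d - 5), (Nat.choose (min 19 (5 + d) - 6) j : ℚ) / ((j + 1) ^ 2)) -
        (∑ j ∈ Finset.range (d - 5), (Nat.choose (min 5 (d - 1)) j : ℚ) / ((j + 1) ^ 2))) *
        ((d * (d + 1) / 2 * (min 19 (5 + d)).choose 3 + d * (d + 1) * (d + 2) / 3 * (min 19 (5 + d)).choose 2 + (d + 4).choose 5 * (min 19 (5 + d)) + (d + 5).choose 6 : ℕ) : ℚ)) ≤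
      15 * 2 ^ (d - 5) * ((p + 5).choose 5 : ℚ) := by
  interval_cases d
  · exact level_five_poly_part_6 p hp
  · exact level_five_poly_part_7 p hp
  · exact level_five_poly_part_8 p hp
  · exact level_five_poly_part_9 p hp
  · exact level_five_poly_part_10 p hp
  · exact level_five_poly_part_11 p hp
  · exact level_five_poly_part_12 p hp
  · exact level_five_poly_part_13 p hp
  · exact level_five_poly_part_14 p hp
  · exact level_five_poly_part_15 p hp
  · exact level_five_poly_part_16 p hp
  · exact level_five_poly_part_17 p hp
  · exact level_five_poly_part_18 p hp
  · exact level_five_poly_part_19 p hp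

/-- **`(P_d)` at level `5` in the `7/8` form, PARTITION count, every corank `20 ≤ d ≤ 25`, every `p ≥ 32`, in `ℚ`** — the
dispatcher of the six cases of RankLevelSetLevelFiveArithPart8. -/
theorem level_five_poly_part8 (d : ℕ) (hd1 : 20 ≤ d) (hd2 : d ≤ 25) (p : ℕ) (hp : 32 ≤ p) :
    8 * (((p + d).choose 5 : ℚ) +
      (∑ j ∈ Finset.range (d - 5), (Nat.choose (min 13 ((d + 6) / 2 + 1 - 2)) j : ℚ) / ((j + 1) ^ 2)) *
        ((d * (d + 1) / 2 * (p + d).choose 3 + d * (d + 1) * (d + 2) / 3 * (p + d).choose 2 + (d + 4).choose 5 * (p + d) + (d + 5).choose 6 : ℕ) : ℚ) +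
      ((∑ j ∈ Finset.range (d - 5), (Nat.choose (min 19 (5 + d) - 6) j : ℚ) / ((j + 1) ^ 2)) -
        (∑ j ∈ Finset.range (d - 5), (Nat.choose (min 5 (d - 1)) j : ℚ) / ((j + 1) ^ 2))) *
        ((d * (d + 1) / 2 * (min 19 (5 + d)).choose 3 + d * (d + 1) * (d + 2) / 3 * (min 19 (5 + d)).choose 2 + (d + 4).choose 5 * (min 19 (5 + d)) + (d + 5).choose 6 : ℕ) : ℚ)) ≤
      7 * 2 ^ (d - 5) * ((p + 5).choose 5 : ℚ) := by
  interval_cases d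
  · exact level_five_poly_part8_20 p hp
  · exact level_five_poly_part8_21 p hp
  · exact level_five_poly_part8_22 p hp
  · exact level_five_poly_part8_23 p hp
  · exact level_five_poly_part8_24 p hp
  · exact level_five_poly_part8_25 p hp

/-- **The regime-II assembly lemma**: from `Φ ≤ 2^(p+5)/C(p+5, 5)`, `U ≤ N`, `C(n, p−1) ≤ Y` and the numeral cell
`2^(p+5)·N ≤ C(p+5, 5)·C(n, p−1)`, conclude `Φ·U ≤ Y`. -/
theorem level_arith_II {p n : ℕ} {Φ U Y N : ℚ}
    (hΦ : Φ ≤ (2 : ℚ) ^ (p + 5) / ((p + 5).choose 5 : ℚ)) (hU0 : 0 ≤ U) (hU : U ≤ N)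
    (hY : (n.choose (p - 1) : ℚ) ≤ Y) (hnum : (2 : ℚ) ^ (p + 5) * N ≤ ((p + 5).choose 5 : ℚ) * (n.choose (p - 1) : ℚ)) :
    Φ * U ≤ Y := by
  have hc : (0 : ℚ) < ((p + 5).choose 5 : ℚ) := by exact_mod_cast Nat.choose_pos (by omega)
  have h1 : Φ * U ≤ (2 : ℚ) ^ (p + 5) / ((p + 5).choose 5 : ℚ) * U := mul_le_mul_of_nonneg_right hΦ hU0
  have h2 : (2 : ℚ) ^ (p + 5) / ((p + 5).choose 5 : ℚ) * U ≤ (2 : ℚ) ^ (p + 5) / ((p + 5).choose 5 : ℚ) * N :=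
    mul_le_mul_of_nonneg_left hU (by positivity)
  have h3 : (2 : ℚ) ^ (p + 5) / ((p + 5).choose 5 : ℚ) * N ≤ (n.choose (p - 1) : ℚ) := by
    rw [div_mul_eq_mul_div, div_le_iff₀ hc]
    linarith
  linarith

namespace ThmN

open Set

variable {α : Type}

/-- **The `e`-free core at level `5`, corank `6 ≤ d ≤ 25`, rank `p ≥ 32`** (the square-multiplicity count in the
partition form, the nullity cap, `f(5) ≤ 19`, Lemmas T and T4, the flat tail / the regime-II count). -/
theorem c025_core_five_bounded_corank_part (M : Matroid α) [M.Finite] (p d : ℕ) (hp : 32 ≤ p) (hd6 : 6 ≤ d)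
    (hd25 : d ≤ 25) (hR : M.eRank = (p : ℕ∞)) (hn : M.E.ncard = p + d)
    (hfree : ∀ e ∈ M.E, ∃ A ⊆ M.E \ {e}, e ∉ M.closure A ∧ e ∉ M.closure ((M.E \ {e}) \ A)) :
    RLS M p 5 := by
  classical
  have hEcard : M.ground_finite.toFinset.card = p + d := by
    rw [← Set.ncard_eq_toFinset_card _ M.ground_finite]; exact hn
  -- the core is simple: every circuit has `≥ 3` elements
  have hL0 : ∀ e ∈ M.E, ¬ M.IsLoop e := not_isLoop_of_free M hfree
  have hs : ∀ e ∈ M.E, ∀ f ∈ M.E, e ≠ f → M.eRk {e, f} = 2 := by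
    intro e he f hf hef
    have h2 : (2 : ℕ∞) ≤ M.eRk {e, f} :=
      two_le_eRk_of_two_le_ncard_of_free M hfree (pair_subset he hf) (by rw [ncard_pair hef])
    have h3 : M.eRk {e, f} ≤ 2 := by
      have := M.eRk_le_encard {e, f}
      rwa [encard_pair hef] at this
    exact le_antisymm h3 h2
  have hcirc : ∀ C, M.IsCircuit C → 3 ≤ C.encard := three_le_encard_of_circuit M hL0 hs
  have hd : M.E.encard = M.eRank + d := by
    rw [hR, ← M.ground_finite.cast_ncard_eq, hn]
    push_cast
    ring
  -- the capped flat bounds: rank-`≤ 5` sets have `≤ min 19 (5 + d)` points, rank-`≤ 4` sets `≤ min 10 (4 + d)`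
  have hflat : ∀ X ⊆ M.E, M.eRk X ≤ 5 → X.ncard ≤ min 19 (5 + d) := fun X hX hr =>
    le_min (ncard_le_nineteen_of_eRk_le_five_of_free M hfree hX hr)
      (ncard_le_add_of_eRk_le_of_encard_eq M hd hX hr)
  have hflat' : ∀ X ⊆ M.E, M.eRk X ≤ ((5 - 1 : ℕ) : ℕ∞) → X.ncard ≤ min 10 (4 + d) := fun X hX hr =>
    le_min (ncard_le_ten_of_eRk_le_four_of_free M hfree hX (by simpa using hr))
      (ncard_le_add_of_eRk_le_of_encard_eq M hd hX (by simpa using hr))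
  -- the circuit counts: Lemma T, Lemma T4, and the nullity bounds
  have hC1 : ∀ L ⊆ M.E, M.eRk L = 2 → L.ncard ≤ 3 :=
    fun L hL hr => ncard_le_three_of_eRk_two M hs hfree hL hr
  have hC1' : ∀ L ⊆ M.E, M.eRk L ≤ 2 → L.ncard ≤ 3 := fun L hL hr => by
    have := ncard_add_one_le_two_pow_of_eRk_le M hL0 hfree 2 L hL hr
    omega
  have hC2 : ∀ P ⊆ M.E, M.eRk P ≤ 3 → P.ncard ≤ 6 :=
    fun P hP hr => ncard_le_six_of_eRk_le_three_of_free M hfree hP hr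
  have hs3 : {C | M.IsCircuit C ∧ C.ncard = 3}.ncard ≤ d * (d + 1) / 2 := by
    have := S1.two_mul_ncard_triangles_le M hC1 hd
    unfold triangles at this
    omega
  have hs4 : {C | M.IsCircuit C ∧ C.ncard = 4}.ncard ≤ d * (d + 1) * (d + 2) / 3 := by
    have := S1.three_mul_ncard_four_circuits_le M hC1' hC2 hd
    omega
  have hs5 : {C | M.IsCircuit C ∧ C.ncard = 5}.ncard ≤ (d + 4).choose 5 :=
    Matroid.ncard_circuits_le_choose_of_encard M hd 4
  have hs6 : {C | M.IsCircuit C ∧ C.ncard = 6}.ncard ≤ (d + 5).choose 6 :=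
    Matroid.ncard_circuits_le_choose_of_encard M hd 5
  -- (U): the square-multiplicity count in the PARTITION form, in `ℚ`, then the circuit bounds
  set ν₁ : ℕ := (d + 6) / 2 + 1 with hν₁
  have hU0 := S2.ncard_eRk_eq_ncard_le_le_giant_sq' M 5 (min 19 (5 + d)) (min 10 (4 + d)) ν₁ 6 (by norm_num)
    hcirc hflat hflat' (hinter_five M hfree) hd (by omega) (by omega) (by omega)
  have hU1 := Matroid.topCount_le_ncard_compl (M := M) hR hd 5
  have hm1 : min (min 19 (5 + d) - 6) (ν₁ - 2) = min 13 ((d + 6) / 2 + 1 - 2) := by omega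
  have hm2 : min 10 (4 + d) - 5 = min 5 (d - 1) := by omega
  have hm3 : min (min 19 (5 + d)) (5 + d) = min 19 (5 + d) := by omega
  simp only [show (5 : ℕ) + 1 = 6 from rfl] at hU0
  rw [hn, sum_Icc_three_six_q, sum_Icc_three_six_q, hm1, hm2, hm3,
    show d - 6 + 1 = d - 5 by omega] at hU0
  simp only [show (6 : ℕ) - 3 = 3 from rfl, show (6 : ℕ) - 4 = 2 from rfl,
    show (6 : ℕ) - 5 = 1 from rfl, show (6 : ℕ) - 6 = 0 from rfl, Nat.choose_one_right,
    Nat.choose_zero_right] at hU0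
  have hUq : (Matroid.topCount M p 5 : ℚ) ≤ ((p + d).choose 5 : ℚ) +
      (∑ j ∈ Finset.range (d - 5), (Nat.choose (min 13 ((d + 6) / 2 + 1 - 2)) j : ℚ) / ((j + 1) ^ 2)) *
        ((d * (d + 1) / 2 * (p + d).choose 3 + d * (d + 1) * (d + 2) / 3 * (p + d).choose 2 +
          (d + 4).choose 5 * (p + d) + (d + 5).choose 6 : ℕ) : ℚ) +
      ((∑ j ∈ Finset.range (d - 5), (Nat.choose (min 19 (5 + d) - 6) j : ℚ) / ((j + 1) ^ 2)) -
        (∑ j ∈ Finset.range (d - 5), (Nat.choose (min 5 (d - 1)) j : ℚ) / ((j + 1) ^ 2))) *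
        ((d * (d + 1) / 2 * (min 19 (5 + d)).choose 3 + d * (d + 1) * (d + 2) / 3 * (min 19 (5 + d)).choose 2 +
          (d + 4).choose 5 * (min 19 (5 + d)) + (d + 5).choose 6 : ℕ) : ℚ) := by
    have hU1q : (Matroid.topCount M p 5 : ℚ) ≤
        ({B : Set α | B ⊆ M.E ∧ M.eRk B = 5 ∧ B.ncard ≤ d}.ncard : ℚ) := by exact_mod_cast hU1
    have hsm : {C | M.IsCircuit C ∧ C.ncard = 3}.ncard * (p + d).choose 3 +
        {C | M.IsCircuit C ∧ C.ncard = 4}.ncard * (p + d).choose 2 +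
        {C | M.IsCircuit C ∧ C.ncard = 5}.ncard * (p + d) + {C | M.IsCircuit C ∧ C.ncard = 6}.ncard * 1 ≤
        d * (d + 1) / 2 * (p + d).choose 3 + d * (d + 1) * (d + 2) / 3 * (p + d).choose 2 +
          (d + 4).choose 5 * (p + d) + (d + 5).choose 6 := by
      have := hs6
      gcongr
      omega
    have hgg : {C | M.IsCircuit C ∧ C.ncard = 3}.ncard * (min 19 (5 + d)).choose 3 +
        {C | M.IsCircuit C ∧ C.ncard = 4}.ncard * (min 19 (5 + d)).choose 2 +
        {C | M.IsCircuit C ∧ C.ncard = 5}.ncard * (min 19 (5 + d)) + {C | M.IsCircuit C ∧ C.ncard = 6}.ncard * 1 ≤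
        d * (d + 1) / 2 * (min 19 (5 + d)).choose 3 + d * (d + 1) * (d + 2) / 3 * (min 19 (5 + d)).choose 2 +
          (d + 4).choose 5 * (min 19 (5 + d)) + (d + 5).choose 6 := by
      gcongr
      omega
    have hsmq : (({C | M.IsCircuit C ∧ C.ncard = 3}.ncard : ℚ) * ((p + d).choose 3 : ℚ) +
        ({C | M.IsCircuit C ∧ C.ncard = 4}.ncard : ℚ) * ((p + d).choose 2 : ℚ) +
        ({C | M.IsCircuit C ∧ C.ncard = 5}.ncard : ℚ) * ((p + d : ℕ) : ℚ) +
        ({C | M.IsCircuit C ∧ C.ncard = 6}.ncard : ℚ) * ((1 : ℕ) : ℚ)) ≤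
        ((d * (d + 1) / 2 * (p + d).choose 3 + d * (d + 1) * (d + 2) / 3 * (p + d).choose 2 +
          (d + 4).choose 5 * (p + d) + (d + 5).choose 6 : ℕ) : ℚ) := by exact_mod_cast hsm
    have hggq : (({C | M.IsCircuit C ∧ C.ncard = 3}.ncard : ℚ) * ((min 19 (5 + d)).choose 3 : ℚ) +
        ({C | M.IsCircuit C ∧ C.ncard = 4}.ncard : ℚ) * ((min 19 (5 + d)).choose 2 : ℚ) +
        ({C | M.IsCircuit C ∧ C.ncard = 5}.ncard : ℚ) * ((min 19 (5 + d) : ℕ) : ℚ) +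
        ({C | M.IsCircuit C ∧ C.ncard = 6}.ncard : ℚ) * ((1 : ℕ) : ℚ)) ≤
        ((d * (d + 1) / 2 * (min 19 (5 + d)).choose 3 + d * (d + 1) * (d + 2) / 3 * (min 19 (5 + d)).choose 2 +
          (d + 4).choose 5 * (min 19 (5 + d)) + (d + 5).choose 6 : ℕ) : ℚ) := by exact_mod_cast hgg
    -- `σ_s ≤ σ_g` (termwise), so the giant excess is non-negative
    have hσ : (∑ j ∈ Finset.range (d - 5), (Nat.choose (min 5 (d - 1)) j : ℚ) / ((j + 1) ^ 2)) ≤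
        ∑ j ∈ Finset.range (d - 5), (Nat.choose (min 19 (5 + d) - 6) j : ℚ) / ((j + 1) ^ 2) := by
      apply Finset.sum_le_sum
      intro j _
      have : (min 5 (d - 1)).choose j ≤ (min 19 (5 + d) - 6).choose j := Nat.choose_le_choose j (by omega)
      have h' : ((min 5 (d - 1)).choose j : ℚ) ≤ ((min 19 (5 + d) - 6).choose j : ℚ) := by exact_mod_cast this
      exact div_le_div_of_nonneg_right h' (by positivity)
    have hσm0 : (0 : ℚ) ≤ ∑ j ∈ Finset.range (d - 5), (Nat.choose (min 13 ((d + 6) / 2 + 1 - 2)) j : ℚ) / ((j + 1) ^ 2) :=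
      Finset.sum_nonneg (fun j _ => by positivity)
    refine hU1q.trans (hU0.trans ?_)
    have e1 := mul_le_mul_of_nonneg_left hsmq hσm0
    have e2 := mul_le_mul_of_nonneg_left hggq (by linarith : (0 : ℚ) ≤
      (∑ j ∈ Finset.range (d - 5), (Nat.choose (min 19 (5 + d) - 6) j : ℚ) / ((j + 1) ^ 2)) -
        (∑ j ∈ Finset.range (d - 5), (Nat.choose (min 5 (d - 1)) j : ℚ) / ((j + 1) ^ 2)))
    linarith
  -- (Y): the flat tail
  have hY := Matroid.two_pow_le_midCount_add (M := M) p 5 hR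
  have hA : {X : Set α | X ⊆ M.E ∧ M.eRk X ≤ 5}.ncard ≤ S2.flatTail (p + d) := by
    have h := S2.ncard_eRk_le_five_le_flat M hfree
    rw [hn] at h
    unfold S2.flatTail
    exact h
  have hB := Matroid.ncard_spanning_le (M := M) hd
  rw [hEcard] at hY hB
  have hΦ := phiK_le_two_pow_div p 5
  rw [Nat.choose_symm_add] at hΦ
  rw [add_assoc] at hUq
  rw [RLS_iff]
  have hYq : (2 : ℚ) ^ (p + d) ≤ (Matroid.midCount M p 5 : ℚ) +
      ({X : Set α | X ⊆ M.E ∧ M.eRk X ≤ 5}.ncard : ℚ) +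
      ({X : Set α | X ⊆ M.E ∧ M.eRk X = M.eRank}.ncard : ℚ) := by exact_mod_cast hY
  have hU0' : (0 : ℚ) ≤ (Matroid.topCount M p 5 : ℚ) := Nat.cast_nonneg _
  have hd5 : 5 ≤ d := by omega
  have htail : ∀ J : ℕ, d ≤ J → ∑ j ∈ Finset.range (d + 1), (p + d).choose j ≤
      ∑ j ∈ Finset.range (J + 1), (p + d).choose j := fun J hJ =>
    Finset.sum_le_sum_of_subset_of_nonneg (Finset.range_mono (by omega)) (fun _ _ _ => Nat.zero_le _)
  rcases Nat.lt_or_ge d 20 with hd19 | hd20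
  · -- coranks `6 … 19`: the `15/16` form
    have hpolyq := level_five_poly_part d hd6 (by omega) p hp
    rw [add_assoc] at hpolyq
    have hAB : 16 * ({X : Set α | X ⊆ M.E ∧ M.eRk X ≤ 5}.ncard +
        {X : Set α | X ⊆ M.E ∧ M.eRk X = M.eRank}.ncard) ≤ 2 ^ (p + d) := by
      rcases Nat.lt_or_ge d 12 with h11 | h12
      · have hT := S2.sixteen_mul_tail_eleven' (p + d) (by omega)
        have h2 := hB.trans (htail 11 (by omega))
        omega
      rcases Nat.lt_or_ge d 14 with h13 | h14
      · have hT := S2.sixteen_mul_tail_thirteen' (p + d) (by omega)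
        have h2 := hB.trans (htail 13 (by omega))
        omega
      rcases Nat.lt_or_ge d 17 with h16 | h17
      · have hT := S2.sixteen_mul_tail_sixteen' (p + d) (by omega)
        have h2 := hB.trans (htail 16 (by omega))
        omega
      rcases Nat.lt_or_ge d 19 with h18 | h19
      · have hT := S2.sixteen_mul_tail_eighteen' (p + d) (by omega)
        have h2 := hB.trans (htail 18 (by omega))
        omega
      · have hT := S2.sixteen_mul_tail_nineteen' (p + d) (by omega)
        have h2 := hB.trans (htail 19 (by omega))
        omega
    have hABq : 16 * (({X : Set α | X ⊆ M.E ∧ M.eRk X ≤ 5}.ncard : ℚ) +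
        ({X : Set α | X ⊆ M.E ∧ M.eRk X = M.eRank}.ncard : ℚ)) ≤ 2 ^ (p + d) := by exact_mod_cast hAB
    exact S2.level_arith16 (p := p) (d := d) (n := p + d) (q := 5) rfl hd5 hΦ hU0' hUq hYq hABq hpolyq
  · -- coranks `20 … 25`: the `7/8` form, or the regime-II count below the tail bases
    rcases Nat.lt_or_ge (p + d) (2 * d + 10) with hII | hT0
    · -- the six regime-II cells
      have hYII : (((p + d).choose (p - 1) : ℕ) : ℚ) ≤ (Matroid.midCount M p 5 : ℚ) := by
        have h := choose_le_midCount_of_bound M hfree (q := 5) (p := p) (B := 19)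
          (fun X hX hr => ncard_le_nineteen_of_eRk_le_five_of_free M hfree hX hr) (by omega)
        rw [hEcard] at h
        exact_mod_cast h
      have hd23 : 23 ≤ d := by omega
      have hnum := S2.level_five_cells_II d p hd23 hd25 hp hII
      rw [add_assoc] at hnum
      exact level_arith_II hΦ hU0' hUq hYII hnum
    · have hpolyq := level_five_poly_part8 d hd20 hd25 p hp
      rw [add_assoc] at hpolyq
      have hAB : 8 * ({X : Set α | X ⊆ M.E ∧ M.eRk X ≤ 5}.ncard +
          {X : Set α | X ⊆ M.E ∧ M.eRk X = M.eRank}.ncard) ≤ 2 ^ (p + d) := by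
        rcases Nat.lt_or_ge d 21 with h20 | h21
        · have hT := S2.eight_mul_tail_twenty (p + d) (by omega)
          have h2 := hB.trans (htail 20 (by omega))
          omega
        rcases Nat.lt_or_ge d 22 with h21' | h22
        · have hT := S2.eight_mul_tail_twentyone (p + d) (by omega)
          have h2 := hB.trans (htail 21 (by omega))
          omega
        rcases Nat.lt_or_ge d 23 with h22' | h23
        · have hT := S2.eight_mul_tail_twentytwo (p + d) (by omega)
          have h2 := hB.trans (htail 22 (by omega))
          omega
        rcases Nat.lt_or_ge d 24 with h23' | h24
        · have hT := S2.eight_mul_tail_twentythree (p + d) (by omega)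
          have h2 := hB.trans (htail 23 (by omega))
          omega
        rcases Nat.lt_or_ge d 25 with h24' | h25
        · have hT := S2.eight_mul_tail_twentyfour (p + d) (by omega)
          have h2 := hB.trans (htail 24 (by omega))
          omega
        · have hT := S2.eight_mul_tail_twentyfive (p + d) (by omega)
          have h2 := hB.trans (htail 25 (by omega))
          omega
      have hABq : 8 * (({X : Set α | X ⊆ M.E ∧ M.eRk X ≤ 5}.ncard : ℚ) +
          ({X : Set α | X ⊆ M.E ∧ M.eRk X = M.eRank}.ncard : ℚ)) ≤ 2 ^ (p + d) := by exact_mod_cast hAB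
      exact level_arith (p := p) (d := d) (n := p + d) (q := 5) rfl hd5 hΦ hU0' hUq hYq hABq hpolyq

/-- **THEOREM C₅, THE PARTITION CHAIN, GIVEN LEVEL `4` FROM `P`**: for every `P ≥ 32`, level `4` for all `p ≥ P`
implies level `5` for all `p ≥ P + 1` (the S2 reduction `rls_five_of_four_of_core P`: coranks `6 … 25` by the cells at
`p ≥ P ≥ 32`, `≥ 26` by `c025_core_five_nineteen`). -/
theorem c025_five_of_four_part_from (P : ℕ) (hP : 32 ≤ P)
    (h4 : ∀ (M : Matroid α) [M.Finite] (p : ℕ), P ≤ p → RLS M p 4) :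
    ∀ (M : Matroid α) [M.Finite] (p : ℕ), P + 1 ≤ p → RLS M p 5 := by
  refine S2.rls_five_of_four_of_core P (by omega) h4 ?_
  intro M _ p hP' hR hbig hfree
  rcases Nat.lt_or_ge M.E.ncard (p + 26) with h | h
  · exact c025_core_five_bounded_corank_part M p (M.E.ncard - p) (by omega) (by omega) (by omega) hR (by omega) hfree
  · exact c025_core_five_nineteen M p (by omega) hR (by omega) hfree

/-- **THEOREM C₅, THE PARTITION CHAIN, GIVEN LEVEL `4`**: level `4` for all `p ≥ 32` implies level `5` for all
`p ≥ 33`. -/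
theorem c025_five_of_four_part (h4 : ∀ (M : Matroid α) [M.Finite] (p : ℕ), 32 ≤ p → RLS M p 4) :
    ∀ (M : Matroid α) [M.Finite] (p : ℕ), 33 ≤ p → RLS M p 5 :=
  c025_five_of_four_part_from 32 le_rfl h4

/-- **THEOREM C₅, THE PARTITION CHAIN, UNCONDITIONAL**: every finite matroid satisfies C-025 at level `5` for every
`p ≥ 44` (level `4` from the split row `c025_four_large_split`, `p ≥ 43`). -/
theorem c025_five_large_part (M : Matroid α) [M.Finite] (p : ℕ) (hp : 44 ≤ p) : RLS M p 5 :=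
  c025_five_of_four_part_from 43 (by norm_num) (fun M _ p hp => c025_four_large_split M p hp) M p hp

/-- The level-`5` statement at `p ≥ 44` in the vocabulary of `C025`. -/
theorem c025_five_large_part' (M : Matroid α) [M.Finite] (p : ℕ) (hp : 44 ≤ p) :
    phiK p 5 * ({A : Set α | A ⊆ M.E ∧ M.eRk A = (p : ℕ∞) ∧ M.eRk (M.E \ A) = (5 : ℕ∞)}.ncard : ℚ) ≤
      ({A : Set α | A ⊆ M.E ∧ (5 : ℕ∞) < M.eRk A ∧ M.eRk A < (p : ℕ∞)}.ncard : ℚ) :=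
  c025_five_large_part M p hp

/-- **THEOREM C₅ AT `33`, UNCONDITIONAL**: every finite matroid satisfies C-025 at level `5` for every `p ≥ 33` (level `4`
from S1's `c025_four_twentyseven`, `p ≥ 27`, through the partition chain from `P = 32`). -/
theorem c025_five_large_part33 (M : Matroid α) [M.Finite] (p : ℕ) (hp : 33 ≤ p) : RLS M p 5 :=
  c025_five_of_four_part_from 32 le_rfl (fun M _ p hp => S1.c025_four_twentyseven M p (by omega)) M p hp

/-- The level-`5` statement at `p ≥ 33` in the vocabulary of `C025`. -/
theorem c025_five_large_part33' (M : Matroid α) [M.Finite] (p : ℕ) (hp : 33 ≤ p) :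
    phiK p 5 * ({A : Set α | A ⊆ M.E ∧ M.eRk A = (p : ℕ∞) ∧ M.eRk (M.E \ A) = (5 : ℕ∞)}.ncard : ℚ) ≤
      ({A : Set α | A ⊆ M.E ∧ (5 : ℕ∞) < M.eRk A ∧ M.eRk A < (p : ℕ∞)}.ncard : ℚ) :=
  c025_five_large_part33 M p hp

end ThmN

end PercRepro
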